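import Literature.Probability.LatticeModels.GaussianFieldReflectionPositivity
import HarnessLib

/-!
# Reflection positivity of Gaussian lattice fields from the VECTOR-level reflected form (finite index sets)

Theorem-only file (no definitions, no named facts).  The tree's `gaussianField_isReflectionPositive` (Glimm–Jaffe Thm. 6.2.2 in lattice
form) asks for the reflected kernel `K(θ·,·)` to be positive semidefinite along finite FAMILIES `z_i ∈ P` with repetitions,
`0 ≤ Σ_{i,j} c_i c_j K(θz_i, z_j)`.  On a FINITE index set `V` this is the same as non-negativity of the reflected form along VECTORS
supported in the half, `0 ≤ Σ_{x,y} u_x K(θx, y) u_y` (`0 ≤ Π₊θCΠ₊`, Glimm–Jaffe Def. 7.10.2): collect the coefficients `c_i` on the fibres of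
`z` (`u_x = Σ_{z_i = x} c_i`).  This file records that bridge and the resulting VECTOR-LEVEL criterion, the form in which reflected positivity is
naturally PROVED for concrete covariances (transfer through block averages, precision criteria) — together with the letter
`Σ_{x,y} u_x K(x,θy) u′_y = ⟨u, K(u′∘θ)⟩` that turns reflected double sums into matrix algebra.

* `family_sum_eq_fiber_sum`: `Σ_{i,j∈s} c_i c_j F(z_i,z_j) = Σ_{x,y} (Σ_{z_i=x} c_i) F(x,y) (Σ_{z_j=y} c_j)`.
* ★ `reflectedKernel_family_nonneg_of_vector`: vector-level ⇒ family-level reflected positivity on `P`.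
* ★ `gaussianField_isReflectionPositive_of_vector` (+ `Real`): `N(0,K)` is reflection positive on all bounded observables measurable in
  the coordinates in `P` as soon as `K` is a `θ`-invariant positive-semidefinite kernel with non-negative reflected form along vectors
  supported in `P`.
* `reflectedForm_eq_dotProduct`: `Σ_{x,y} u_x K(x,θy) u′_y = ⟨u, K(u′∘θ)⟩` for an involution `θ`.

## References

* J. Glimm, A. Jaffe, *Quantum Physics. A Functional Integral Point of View* (2nd ed., Springer 1987), §6.2 Thm. 6.2.2, §7.10 Def. 7.10.2. [GlimmJaffe1987]
* J. Fröhlich, R. Israel, E. H. Lieb, B. Simon, Comm. Math. Phys. 62 (1978) 1–34, Thm. 2.1, §3. [FILS1978]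
* M. Biskup, *Reflection positivity and phase transitions in lattice spin models*, LNM 1970 (2009), §5.1 Def. 5.2, Lemma 5.6. [Biskup2009]
-/

noncomputable section

open Finset Matrix
open scoped BigOperators

universe u

namespace Literature.Probability.LatticeModels

open Literature.MathematicalPhysics.QuantumFieldTheory (IsPosSemidefKernel gaussianFieldOfKernel)

section VectorRP

variable {V : Type u} [Fintype V]

/-- **The reflected form as a dot product**: `Σ_{x,y} u_x K(x,θy) u′_y = ⟨u, K(u′∘θ)⟩` for an involution `θ` (any real matrix `K`).
[cite: GlimmJaffe1987, §7.10 Def. 7.10.2 (`Π₊θCΠ₊` as a form)] -/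
theorem reflectedForm_eq_dotProduct (K : Matrix V V ℝ) {θ : V ≃ V} (hθ : Function.Involutive θ) (u u' : V → ℝ) :
    ∑ x, ∑ y, u x * K x (θ y) * u' y = u ⬝ᵥ (K *ᵥ fun y => u' (θ y)) := by
  simp only [dotProduct, mulVec, Finset.mul_sum]
  refine Finset.sum_congr rfl fun x _ => ?_
  calc ∑ y, u x * K x (θ y) * u' y = ∑ y, u x * K x (θ (θ y)) * u' (θ y) :=
        (Equiv.sum_comp θ (fun y => u x * K x (θ y) * u' y)).symm
    _ = ∑ y, u x * (K x y * u' (θ y)) := Finset.sum_congr rfl fun y _ => by rw [hθ y]; ring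

/-- **Re-indexing a family double sum by the fibres of the point map**:
`Σ_{i,j∈s} c_i c_j F(z_i,z_j) = Σ_{x,y} (Σ_{z_i=x} c_i) F(x,y) (Σ_{z_j=y} c_j)`. [cite: Biskup2009, §5.1 Lemma 5.6 (quadratic forms)] -/
theorem family_sum_eq_fiber_sum [DecidableEq V] (F : V → V → ℝ) {ι : Type*} (s : Finset ι) (c : ι → ℝ) (z : ι → V) :
    ∑ i ∈ s, ∑ j ∈ s, c i * c j * F (z i) (z j)
      = ∑ x, ∑ y, (∑ i ∈ s with z i = x, c i) * F x y * (∑ j ∈ s with z j = y, c j) := by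
  have inner : ∀ i, ∑ j ∈ s, c i * c j * F (z i) (z j) = ∑ y, c i * F (z i) y * ∑ j ∈ s with z j = y, c j := by
    intro i
    rw [← Finset.sum_fiberwise s z (fun j => c i * c j * F (z i) (z j))]
    refine Finset.sum_congr rfl fun y _ => ?_
    rw [Finset.mul_sum]
    refine Finset.sum_congr rfl fun j hj => ?_
    rw [(Finset.mem_filter.1 hj).2]
    ring
  rw [Finset.sum_congr rfl fun i _ => inner i,
    ← Finset.sum_fiberwise s z (fun i => ∑ y, c i * F (z i) y * ∑ j ∈ s with z j = y, c j)]
  refine Finset.sum_congr rfl fun x _ => ?_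
  rw [Finset.sum_comm]
  refine Finset.sum_congr rfl fun y _ => ?_
  rw [Finset.sum_mul, Finset.sum_mul]
  refine Finset.sum_congr rfl fun i hi => ?_
  rw [(Finset.mem_filter.1 hi).2]

/-- ★ **FAMILIES FROM VECTORS**: if the reflected kernel `K(θ·,·)` has non-negative form along every VECTOR supported in `P`
(`0 ≤ Σ_{x,y} u_x K(θx,y) u_y`), then it is non-negative along every finite FAMILY `z_i ∈ P` with repetitions
(`0 ≤ Σ_{i,j∈s} c_i c_j K(θz_i, z_j)` — hypothesis `hRP` of `gaussianField_isReflectionPositive`).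
[cite: GlimmJaffe1987, §6.2 Thm. 6.2.2, §7.10 Def. 7.10.2] [cite: Biskup2009, §5.1 Lemma 5.6] -/
theorem reflectedKernel_family_nonneg_of_vector [DecidableEq V] (K : V → V → ℝ) (θ : V → V) {P : Set V}
    (h : ∀ u : V → ℝ, (∀ x, x ∉ P → u x = 0) → 0 ≤ ∑ x, ∑ y, u x * K (θ x) y * u y)
    {ι : Type*} (s : Finset ι) (c : ι → ℝ) (z : ι → V) (hz : ∀ i ∈ s, z i ∈ P) :
    0 ≤ ∑ i ∈ s, ∑ j ∈ s, c i * c j * K (θ (z i)) (z j) := by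
  rw [family_sum_eq_fiber_sum (fun x y => K (θ x) y) s c z]
  set u : V → ℝ := fun x => ∑ i ∈ s with z i = x, c i with hu
  have hu0 : ∀ x, x ∉ P → u x = 0 := fun x hx => by
    rw [hu]
    refine Finset.sum_eq_zero fun i hi => ?_
    exfalso
    obtain ⟨hi1, hi2⟩ := Finset.mem_filter.1 hi
    exact hx (hi2 ▸ hz i hi1)
  refine (h u hu0).trans_eq (Finset.sum_congr rfl fun x _ => Finset.sum_congr rfl fun y _ => ?_)
  simp only [hu]

/-- ★ **VECTOR-LEVEL REFLECTED POSITIVITY OF THE KERNEL GIVES REFLECTION POSITIVITY OF THE GAUSSIAN FIELD** (finite index set): for a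
positive-semidefinite kernel `K` invariant under the involution `θ` whose reflected form is non-negative along every vector supported in `P`,
`N(0,K)` is reflection positive on ALL bounded observables measurable in the coordinates in `P` (the tree's `IsReflectionPositive`).
[cite: GlimmJaffe1987, §6.2 Thm. 6.2.2] [cite: FILS1978, Thm. 2.1] [cite: Biskup2009, §5.1 Def. 5.2, Lemma 5.6] -/
theorem gaussianField_isReflectionPositive_of_vector [DecidableEq V] {K : V → V → ℝ} (hK : IsPosSemidefKernel K) (θ : V ≃ V)
    (hθK : ∀ a b, K (θ a) (θ b) = K a b) (hθ : Function.Involutive θ) {P : Set V}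
    (h : ∀ u : V → ℝ, (∀ x, x ∉ P → u x = 0) → 0 ≤ ∑ x, ∑ y, u x * K (θ x) y * u y) :
    IsReflectionPositive (gaussianFieldOfKernel K) θ P :=
  gaussianField_isReflectionPositive hK θ hθK hθ fun _ s c z hz => reflectedKernel_family_nonneg_of_vector K θ h s c z hz

/-- The real form under the same hypotheses. [cite: GlimmJaffe1987, §6.2 Thm. 6.2.2] [cite: Biskup2009, §5.1 Def. 5.2] -/
theorem gaussianField_isReflectionPositiveReal_of_vector [DecidableEq V] {K : V → V → ℝ} (hK : IsPosSemidefKernel K) (θ : V ≃ V)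
    (hθK : ∀ a b, K (θ a) (θ b) = K a b) (hθ : Function.Involutive θ) {P : Set V}
    (h : ∀ u : V → ℝ, (∀ x, x ∉ P → u x = 0) → 0 ≤ ∑ x, ∑ y, u x * K (θ x) y * u y) :
    IsReflectionPositiveReal (gaussianFieldOfKernel K) θ P :=
  (gaussianField_isReflectionPositive_of_vector hK θ hθK hθ h).real

omit [Fintype V] in
/-- For a `θ`-invariant kernel and an involution `θ`, the two placements of the reflection agree: `K(x, θy) = K(θx, y)`.
[cite: GlimmJaffe1987, §7.10 Def. 7.10.1] -/
theorem reflect_right_eq_reflect_left {K : V → V → ℝ} {θ : V → V} (hθK : ∀ a b, K (θ a) (θ b) = K a b)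
    (hθ : Function.Involutive θ) (x y : V) : K x (θ y) = K (θ x) y := by
  rw [← hθK x (θ y), hθ y]

end VectorRP

end Literature.Probability.LatticeModels
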